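import Mathlib
import HarnessLib

/-!
# The Frankl–Wilson theorem: `L`-intersecting families have at most `Σ_{i ≤ |L|} C(n, i)` members

S. Jukna, *Extremal Combinatorics — with applications in computer science* (2nd ed., Springer 2011)
[Jukna2011], Chapter 14 "The basic method" (the linear algebra method), §14.3 "Spaces of
polynomials": Lemma 14.11 (the triangular criterion, p. 190) and Theorem 14.13 (p. 191) with the
proof of Babai (1988) printed there; original: P. Frankl, R. M. Wilson, *Intersection theorems with
geometric consequences*, Combinatorica 1 (1981) 357–368 [FranklWilson1981].

A family `𝓕` of subsets of an `n`-set is `L`-intersecting if `|A ∩ B| ∈ L` for all distinct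
`A, B ∈ 𝓕`.  **Theorem 14.13 (Frankl–Wilson 1981).** Then `|𝓕| ≤ Σ_{i=0}^{|L|} C(n, i)`.

PROVED here (theorems only), following the printed proof: `{0,1}^n` is modelled as `Finset α`
(`Fintype α`), functions on it as `Finset α → ℝ`, the incidence-vector scalar product `⟨v_A, x⟩` at
`x = v_B` is `|A ∩ B|`, and the "pure" (multilinear) monomial of `S` is the function
`χ_S(B) = [S ⊆ B]`.
* `linearIndependent_of_triangular_eval` — **Lemma 14.11**: `f_i(v_i) ≠ 0` and `f_j(v_i) = 0` for
  `i` before `j` force linear independence (phrased with a ranking `r : ι → ℕ`; "before" =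
  `r i ≤ r j, i ≠ j`).
* `monomial_mul_var`, `linearFactor_mul_mem_span`, `babaiFun_mem_span` — on `{0,1}^n`,
  `x_k² = x_k`, so `f_A = ∏_{l ∈ L, l < |A|} (⟨v_A, x⟩ − l)` lies in the span of the monomials of
  degree `≤ |L|`.
* **`frankl_wilson`** — Theorem 14.13: the `f_A` are linearly independent (triangular with respect to
  `|A|`, as `|A ∩ B| < |B|` for distinct members with `|A| ≤ |B|`) inside a span of at most
  `Σ_{i ≤ |L|} C(n,i)` monomials (Mathlib's `linearIndependent_le_span_aux'`).

Not treated: the uniform Ray-Chaudhuri–Wilson bound `C(n, |L|)` and the modular version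
Theorem 14.14 (Deza–Frankl–Singhi).

## References

* [Jukna2011] S. Jukna, *Extremal Combinatorics*, 2nd ed., Springer (2011), Lemma 14.11,
  Theorem 14.13 and its proof (held text
  `book:jukna2011-extremal-combinatorics-with-applications-computer-science`, chunks 176–178).
* [FranklWilson1981] P. Frankl, R. M. Wilson, Combinatorica 1 (1981) 357–368.
-/

namespace Literature.Combinatorics.SetFamily

open Finset

/-! ### Lemma 14.11: the triangular criterion -/

/-- **Lemma 14.11 (triangular criterion for linear independence).** Let `f_i : Ω → 𝔽` be functions
and `v_i ∈ Ω` points with `f_i(v_i) ≠ 0` and `f_j(v_i) = 0` whenever `i` comes before `j`; then the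
`f_i` are linearly independent in `𝔽^Ω`.  Stated with a ranking `r : ι → ℕ` in place of the linear
order (`f_j(v_i) = 0` whenever `i ≠ j` and `r i ≤ r j`), which is what the application uses.
Printed proof: in a nontrivial relation take the (an `r`-)least `i` with `λ_i ≠ 0` and substitute
`v_i`. [cite: Jukna2011, Ch. 14 §14.3, Lemma 14.11 (p. 190)] -/
theorem linearIndependent_of_triangular_eval {ι Ω 𝔽 : Type*} [Field 𝔽] (f : ι → Ω → 𝔽) (v : ι → Ω)
    (r : ι → ℕ) (ha : ∀ i, f i (v i) ≠ 0) (hb : ∀ i j, i ≠ j → r i ≤ r j → f j (v i) = 0) :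
    LinearIndependent 𝔽 f := by
  classical
  rw [linearIndependent_iff']
  intro s g hrel
  by_contra hne
  push Not at hne
  obtain ⟨i₀, hi₀s, hi₀⟩ : ∃ i ∈ s.filter (fun i => g i ≠ 0), ∀ j ∈ s.filter (fun i => g i ≠ 0),
      r i ≤ r j := by
    obtain ⟨i, hi, hgi⟩ := hne
    exact Finset.exists_min_image _ r ⟨i, Finset.mem_filter.mpr ⟨hi, hgi⟩⟩
  rw [Finset.mem_filter] at hi₀s
  have h := congrFun hrel (v i₀)
  simp only [Finset.sum_apply, Pi.smul_apply, smul_eq_mul, Pi.zero_apply] at h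
  rw [Finset.sum_eq_single i₀] at h
  · exact hi₀s.2 ((mul_eq_zero.mp h).resolve_right (ha i₀))
  · intro j hj hji
    by_cases hgj : g j = 0
    · rw [hgj, zero_mul]
    · rw [hb i₀ j (Ne.symm hji) (hi₀ j (Finset.mem_filter.mpr ⟨hj, hgj⟩)), mul_zero]
  · intro h0; exact absurd hi₀s.1 h0

/-! ### Theorem 14.13: the Frankl–Wilson theorem -/

section FranklWilson

variable {α : Type*} [DecidableEq α]

/-- The (multilinear) monomial functions on `{0,1}^n = 𝒫(α)`: `χ_S(B) = [S ⊆ B] = ∏_{k ∈ S} x_k(B)`.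
[cite: Jukna2011, Ch. 14 §14.3, proof of Theorem 14.13 ("pure monomials of degree `≤ s`")] -/
theorem monomial_mul_var (S : Finset α) (k : α) (B : Finset α) :
    (if S ⊆ B then (1 : ℝ) else 0) * (if k ∈ B then 1 else 0) =
      if insert k S ⊆ B then 1 else 0 := by
  by_cases h1 : S ⊆ B <;> by_cases h2 : k ∈ B <;> simp [h1, h2, Finset.insert_subset_iff]

/-- Multiplying a function in the span of the monomials of degree `≤ d` by a linear factor
`⟨v_A, x⟩ − l = |A ∩ B| − l` lands in the span of the monomials of degree `≤ d + 1` (on `{0,1}^n`,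
`x_k · x_S = x_{S ∪ {k}}`). [cite: Jukna2011, Ch. 14 §14.3, proof of Theorem 14.13] -/
theorem linearFactor_mul_mem_span [Fintype α] (A : Finset α) (l : ℝ) (d : ℕ)
    (g : Finset α → ℝ)
    (hg : g ∈ Submodule.span ℝ
      (((Finset.univ : Finset (Finset α)).filter (fun S => S.card ≤ d)).image
        (fun S => fun B : Finset α => if S ⊆ B then (1 : ℝ) else 0) : Set (Finset α → ℝ))) :
    (fun B => (((A ∩ B).card : ℝ) - l) * g B) ∈ Submodule.span ℝ
      (((Finset.univ : Finset (Finset α)).filter (fun S => S.card ≤ d + 1)).image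
        (fun S => fun B : Finset α => if S ⊆ B then (1 : ℝ) else 0) : Set (Finset α → ℝ)) := by
  -- multiplication by the fixed function `h(B) = |A ∩ B| − l` is linear
  set W := Submodule.span ℝ
      (((Finset.univ : Finset (Finset α)).filter (fun S => S.card ≤ d + 1)).image
        (fun S => fun B : Finset α => if S ⊆ B then (1 : ℝ) else 0) : Set (Finset α → ℝ)) with hW
  have hmono : ∀ S : Finset α, S.card ≤ d + 1 →
      (fun B : Finset α => if S ⊆ B then (1 : ℝ) else 0) ∈ W := by
    intro S hS
    apply Submodule.subset_span
    simp only [Finset.coe_image, Finset.coe_filter, Finset.mem_univ, true_and, Set.mem_image,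
      Set.mem_setOf_eq]
    exact ⟨S, hS, rfl⟩
  refine Submodule.span_induction (p := fun g _ => (fun B => (((A ∩ B).card : ℝ) - l) * g B) ∈ W)
    ?_ ?_ ?_ ?_ hg
  · -- generators `χ_S`, `|S| ≤ d`
    intro g hg
    simp only [Finset.coe_image, Finset.coe_filter, Finset.mem_univ, true_and, Set.mem_image,
      Set.mem_setOf_eq] at hg
    obtain ⟨S, hS, rfl⟩ := hg
    have key : (fun B => (((A ∩ B).card : ℝ) - l) * (if S ⊆ B then (1 : ℝ) else 0)) =
        ∑ k ∈ A, (fun B => if insert k S ⊆ B then (1 : ℝ) else 0) -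
          l • (fun B => if S ⊆ B then (1 : ℝ) else 0) := by
      funext B
      simp only [Pi.sub_apply, Finset.sum_apply, Pi.smul_apply, smul_eq_mul]
      have hcard : ((A ∩ B).card : ℝ) = ∑ k ∈ A, (if k ∈ B then (1 : ℝ) else 0) := by
        rw [Finset.sum_boole, Finset.filter_mem_eq_inter]
      rw [hcard, sub_mul, Finset.sum_mul]
      congr 1
      exact Finset.sum_congr rfl fun k _ => by rw [mul_comm]; exact monomial_mul_var S k B
    rw [key]
    refine W.sub_mem (W.sum_mem fun k _ => hmono _ ?_) (W.smul_mem _ (hmono _ (by omega)))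
    exact (Finset.card_insert_le _ _).trans (by omega)
  · have : (fun B => (((A ∩ B).card : ℝ) - l) * (0 : Finset α → ℝ) B) = 0 := by
      funext B; simp
    rw [this]; exact W.zero_mem
  · intro g₁ g₂ _ _ h1 h2
    have : (fun B => (((A ∩ B).card : ℝ) - l) * (g₁ + g₂) B) =
        (fun B => (((A ∩ B).card : ℝ) - l) * g₁ B) + fun B => (((A ∩ B).card : ℝ) - l) * g₂ B := by
      funext B; simp only [Pi.add_apply]; ring
    rw [this]; exact W.add_mem h1 h2
  · intro c g _ h
    have : (fun B => (((A ∩ B).card : ℝ) - l) * (c • g) B) =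
        c • fun B => (((A ∩ B).card : ℝ) - l) * g B := by
      funext B; simp only [Pi.smul_apply, smul_eq_mul]; ring
    rw [this]; exact W.smul_mem c h

/-- The Babai polynomials `f_A(x) = ∏_{l ∈ L, l < |A|} (⟨v_A, x⟩ − l)`, as functions on `{0,1}^n`,
lie in the span of the monomials of degree `≤ |L|`.
[cite: Jukna2011, Ch. 14 §14.3, proof of Theorem 14.13] -/
theorem babaiFun_mem_span [Fintype α] (A : Finset α) (T : Finset ℕ) :
    (fun B : Finset α => ∏ l ∈ T, (((A ∩ B).card : ℝ) - l)) ∈ Submodule.span ℝ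
      (((Finset.univ : Finset (Finset α)).filter (fun S => S.card ≤ T.card)).image
        (fun S => fun B : Finset α => if S ⊆ B then (1 : ℝ) else 0) : Set (Finset α → ℝ)) := by
  induction T using Finset.induction with
  | empty =>
    apply Submodule.subset_span
    simp only [Finset.prod_empty, Finset.card_empty, Finset.coe_image, Finset.coe_filter,
      Finset.mem_univ, true_and, Set.mem_image, Set.mem_setOf_eq]
    exact ⟨∅, le_rfl, by funext B; simp⟩
  | insert l T hl ih =>
    have := linearFactor_mul_mem_span A (l : ℝ) T.card _ ih
    rw [Finset.card_insert_of_notMem hl]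
    convert this using 2 with B
    rw [Finset.prod_insert hl]

/-- **Theorem 14.13 (Frankl–Wilson 1981; proof of Babai 1988).** If `𝓕` is an `L`-intersecting family
of subsets of an `n`-element set — `|A ∩ B| ∈ L` for all distinct `A, B ∈ 𝓕` — then
`|𝓕| ≤ Σ_{i=0}^{|L|} C(n, i)`. [cite: Jukna2011, Ch. 14 §14.3, Theorem 14.13 (pp. 191–192);
FranklWilson1981] -/
theorem frankl_wilson [Fintype α] (L : Finset ℕ) (𝓕 : Finset (Finset α))
    (hL : ∀ A ∈ 𝓕, ∀ B ∈ 𝓕, A ≠ B → (A ∩ B).card ∈ L) :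
    𝓕.card ≤ ∑ i ∈ Finset.range (L.card + 1), (Fintype.card α).choose i := by
  classical
  -- the functions `f_A`, `A ∈ 𝓕`
  set f : 𝓕 → (Finset α → ℝ) :=
    fun A B => ∏ l ∈ L.filter (fun l => l < (A : Finset α).card), ((((A : Finset α) ∩ B).card : ℝ) - l)
    with hf
  -- Lemma 14.11: they are linearly independent
  have hli : LinearIndependent ℝ f := by
    refine linearIndependent_of_triangular_eval f (fun A => (A : Finset α)) (fun A => (A : Finset α).card)
      (fun A => ?_) (fun A A' hne hle => ?_)
    · simp only [hf, Finset.inter_self]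
      rw [Finset.prod_ne_zero_iff]
      intro l hl
      rw [Finset.mem_filter] at hl
      exact sub_ne_zero.mpr (by exact_mod_cast hl.2.ne')
    · simp only [hf]
      have hne' : (A' : Finset α) ≠ (A : Finset α) := fun h => hne (Subtype.ext h).symm
      have hmem : ((A' : Finset α) ∩ (A : Finset α)).card ∈ L := hL _ A'.2 _ A.2 hne'
      have hlt : ((A' : Finset α) ∩ (A : Finset α)).card < (A' : Finset α).card := by
        refine lt_of_le_of_ne (Finset.card_le_card Finset.inter_subset_left) fun h => hne' ?_
        have h1 : (A' : Finset α) ∩ (A : Finset α) = (A' : Finset α) :=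
          Finset.eq_of_subset_of_card_le Finset.inter_subset_left h.ge
        have h2 : (A' : Finset α) ⊆ (A : Finset α) := by rw [← h1]; exact Finset.inter_subset_right
        exact Finset.eq_of_subset_of_card_le h2 (by rw [← h1]; exact hle.trans (by rw [h1]))
      exact Finset.prod_eq_zero (Finset.mem_filter.mpr ⟨hmem, hlt⟩) (sub_self _)
  -- they lie in the span of the monomials of degree `≤ |L|`
  set T := ((Finset.univ : Finset (Finset α)).filter (fun S => S.card ≤ L.card)).image
      (fun S => fun B : Finset α => if S ⊆ B then (1 : ℝ) else 0) with hT
  have hspan : Set.range f ≤ Submodule.span ℝ (T : Set (Finset α → ℝ)) := by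
    rintro g ⟨A, rfl⟩
    have h1 := babaiFun_mem_span (A : Finset α) (L.filter (fun l => l < (A : Finset α).card))
    have hmono : Submodule.span ℝ ((((Finset.univ : Finset (Finset α)).filter
        (fun S => S.card ≤ (L.filter (fun l => l < (A : Finset α).card)).card)).image
        (fun S => fun B : Finset α => if S ⊆ B then (1 : ℝ) else 0) : Set (Finset α → ℝ))) ≤
        Submodule.span ℝ (T : Set (Finset α → ℝ)) := by
      apply Submodule.span_mono
      intro g hg
      simp only [hT, Finset.coe_image, Finset.coe_filter, Finset.mem_univ, true_and, Set.mem_image,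
        Set.mem_setOf_eq] at hg ⊢
      obtain ⟨S, hS, rfl⟩ := hg
      exact ⟨S, hS.trans (Finset.card_filter_le _ _), rfl⟩
    exact hmono h1
  -- the linear algebra bound
  have hcard := linearIndependent_le_span_aux' f hli (T : Set (Finset α → ℝ)) hspan
  simp only [Finset.coe_sort_coe, Fintype.card_coe] at hcard
  refine hcard.trans ((Finset.card_image_le).trans ?_)
  -- count the monomials of degree `≤ |L|`
  have hdecomp : (Finset.univ : Finset (Finset α)).filter (fun S => S.card ≤ L.card) =
      (Finset.range (L.card + 1)).biUnion (fun i => Finset.powersetCard i Finset.univ) := by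
    ext S
    simp only [Finset.mem_filter, Finset.mem_univ, true_and, Finset.mem_biUnion, Finset.mem_range,
      Finset.mem_powersetCard, Finset.subset_univ]
    constructor
    · intro h; exact ⟨S.card, Nat.lt_succ_of_le h, rfl⟩
    · rintro ⟨i, hi, rfl⟩; omega
  rw [hdecomp]
  refine Finset.card_biUnion_le.trans (Finset.sum_le_sum fun i _ => ?_)
  rw [Finset.card_powersetCard, Finset.card_univ]

end FranklWilson

end Literature.Combinatorics.SetFamily
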